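import Literature.AlgebraicTopology.SingularHomology.UniverseTransportIso
import Literature.AlgebraicTopology.SingularHomology.FundamentalClassProofs
import HarnessLib

/-!
# Local homology of topological manifolds in every universe, off the top degree
(discharge of `isZero_localHomology` for `X : Type u`)

`…LocalHomologyVanishing` proves the named fact
`Literature.AlgebraicTopology.SingularHomology.isZero_localHomology R M X` (`Hₖ(X | x; M) = 0` for
`k ≠ n`) of `…Orientation` for topological `n`-manifolds `X : Type` only, because the comparison
with the model `ℝⁿ : Type` by induced maps of singular homology requires one universe (A. Hatcher,
*Algebraic Topology* (2002), §3.3, p. 231: "`Hₖ(M | x) ≅ Hₖ(ℝⁿ | 0)` by excision"); the companion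
fact `nonempty_localHomology_iso` (`Hₙ(X | x; R) ≅ R`) was extended to every universe in
`…FundamentalClassProofs` (`nonempty_localHomology_iso_holds'`, through a `Nonempty` comparison).
With the explicit cross-universe comparison equivalences of `…UniverseTransportIso`:

* `localHomology.chartXEquiv R M c hx k : Hₖ(X | x; M) ≃ₗ[R] Hₖ(ℝⁿ | c x; M)` for a chart
  `c : X ⇀ ℝⁿ` at `x` of a space `X : Type u` — excision to `c.source`, the homeomorphism
  `c.source ≃ₜ c.target` *across universes* (`localHomology.xEquiv`), excision from `c.target`
  to `ℝⁿ` — an explicit equivalence, compatible by construction with restriction maps;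
* `isZero_localHomology_holds'` — the named fact for every `X : Type u`; explicit-argument forms
  `isZero_localHomology_of_ne`, `not_isZero_localHomology`.

Everything is proved; nothing is asserted.

## References

* A. Hatcher, *Algebraic Topology*, CUP 2002, §3.3 p. 231, Thm. 2.20. [HatcherAT2002]
-/

noncomputable section

open CategoryTheory Limits Set

universe u v

namespace Literature.AlgebraicTopology.SingularHomology

variable (R : Type v) [CommRing R] (M : Type v) [AddCommGroup M] [Module R M]

/-- **`Hₖ(X | x; M) ≃ₗ[R] Hₖ(ℝⁿ | c x; M)` along a chart `c : X ⇀ ℝⁿ` at `x`, for `X` in any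
universe** (Hatcher 2002, §3.3 p. 231: local homology depends only on a neighbourhood; excision,
Thm. 2.20, on both sides of the cross-universe homeomorphism `c.source ≃ₜ c.target`).
[cite: HatcherAT2002, §3.3 p. 231] -/
def localHomology.chartXEquiv {n : ℕ} {X : Type u} [TopologicalSpace X] [T1Space X]
    (c : OpenPartialHomeomorph X (EuclideanSpace ℝ (Fin n))) {x : X} (hx : x ∈ c.source) (k : ℕ) :
    localHomology R M X x k ≃ₗ[R] localHomology R M (EuclideanSpace ℝ (Fin n)) (c x) k :=
  (localHomology.openSubsetIso R M c.open_source hx k).symm.toLinearEquiv ≪≫ₗ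
    (localHomology.xEquiv R M c.toHomeomorphSourceTarget ⟨x, hx⟩ k ≪≫ₗ
      (localHomology.openSubsetIso R M c.open_target (c.map_source hx) k).toLinearEquiv)

/-- **Discharge of the named fact `Literature.AlgebraicTopology.SingularHomology.isZero_localHomology`
for spaces in every universe** (Hatcher 2002, §3.3, p. 231): on a topological `n`-manifold
`X : Type u`, `Hₖ(X | x; M) = 0` for every point `x` and every `k ≠ n`, for every commutative
ring `R` and `R`-module `M` (the `Type` version `isZero_localHomology_holds` applied to `ℝⁿ`,
transported along `localHomology.chartXEquiv`). [cite: HatcherAT2002, §3.3 p. 231] -/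
theorem isZero_localHomology_holds' (X : Type u) [TopologicalSpace X] :
    isZero_localHomology R M (X := X) := by
  intro n _ _ x k hk
  exact (isZero_iff_of_linearEquiv R (localHomology.chartXEquiv R M
    (chartAt (EuclideanSpace ℝ (Fin n)) x) (mem_chart_source _ x) k)).2
      (isZero_localHomology_holds R M (EuclideanSpace ℝ (Fin n))
        (chartAt (EuclideanSpace ℝ (Fin n)) x x) hk)

/-- **`Hₖ(X | x; M) = 0` for `k ≠ n`**, explicit-argument form of `isZero_localHomology_holds'`
for a Hausdorff space `X : Type u` charted on `ℝⁿ`. [cite: HatcherAT2002, §3.3 p. 231] -/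
theorem isZero_localHomology_of_ne {n : ℕ} {X : Type u} [TopologicalSpace X] [T2Space X]
    [ChartedSpace (EuclideanSpace ℝ (Fin n)) X] (x : X) {k : ℕ} (hk : k ≠ n) :
    IsZero (localHomology R M X x k) :=
  isZero_localHomology_holds' R M X x hk

/-- The top local homology of a topological `n`-manifold in any universe is nonzero when `R ≠ 0`
(`localHomology.nonempty_linearEquiv` of `…FundamentalClassProofs`). [folklore] -/
theorem not_isZero_localHomology {n : ℕ} {X : Type u} [TopologicalSpace X] [T2Space X]
    [ChartedSpace (EuclideanSpace ℝ (Fin n)) X] [Nontrivial R] (x : X) :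
    ¬ IsZero (localHomology R R X x n) := fun h ↦ by
  obtain ⟨e⟩ := localHomology.nonempty_linearEquiv R (n := n) x
  haveI := ModuleCat.subsingleton_of_isZero h
  exact not_subsingleton R e.symm.toEquiv.subsingleton

end Literature.AlgebraicTopology.SingularHomology
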